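import Summits.QuantumFields.YangMills.Theorems.BalabanUVNodesN15TwoGridDressedSiteLayerN15At
import Summits.QuantumFields.YangMills.Theorems.BalabanUVNodesN15TwoGridDressedUnitLayerN15AtPinned
import HarnessLib

/-!
# N15 (NE2) — PROGRAMME Σ, part Σ-B: the ALL-LAYERS-BACKGROUND-LIVE family of the pair of record — non-vacuity, the family-keyed editions (`d + 1 = 4`, block factor `F.L`), and the two
# `GuardedReading`-corner faces under a PIN of the reading's NE2 objects to Σ-A's literal `allLayersBgObjects` (pattern Λ-G ∕ Λ-H; drop-ins for a would-be re-pin of K3⁸'s `N15PinnedSized`)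

WHO ∕ WHEN.  Cell `pub-ymgap`, seat `pub-ymgap-dag-n15-a` (KNIT-BY-NAME seat of Track-A DAG node N15 = NE2, g28); `--kind proof --supports stmt-QuantumFields-27366 --as helper` (K3⁸;
count-neutral).  THEOREMS ONLY (0 `def`).  Over Σ-A `…TwoGridDressedSiteLayerN15At` (`allLayersBgObjects`, `n15At_∕live_allLayersBgObjects`, `foSiteBg_one`), Λ-G `…TwoGridDressedUnitLayerFaces`
(`exists_reg335_ne_one`, `three_le_blockFactor`), dag-n15-w2's `PairedFamilyGuard` (`Live`, `KeyedLive`), RR-1's Stage-13 `CoPH` reading types (`RateReading₁₃CoPH`, `rateCarriersOfRecord₁₃CoPH`),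
part 30 (`s_N15_of_admits`, `neZero_blockFactor`) BY NAME; nothing in the tree is modified.

WHAT.  §1 `populated_allLayersBgObjects`; ★ `exists_reg335_ne_one_allLayers` (the `∀ U ∈ (3.35)` clauses of all THREE layer predicates on this family quantify over more than `U ≡ 1` — Λ-G's
exhibit re-read; the three kernels are functions of `U` by construction: Λ-C entries 1–3, Σ-A `foSiteBg`, Λ-F `foCovBg`).  §2 family-keyed editions at `(d, L) := (3, F.L)`:
`n15At_∕live_∕populated_allLayersBgObjects_family`, ★★ `live_and_n15At_allLayersBgObjects_family`, ★★ `s_N15_of_admits_allLayersBg_family`.  §3 ★★ `keyedLive_of_pinnedAllLayersBg` (pinned ⟹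
w2's `KeyedLive`, every run-length selector), ★★ `live_and_n15At_rrOfRecord_of_pinnedAllLayersBg` (pinned ⟹ `Live ∧ N15At` at every Stage-13 bundle of record), ★★
`n15At_lit_of_pinnedAllLayersBg` (pinned ⟹ `N15At` at EVERY run length `k`, not only the selected one) — hypothesis = the body a `N15Pinned…` conjunct re-pinned to this family would have:
`∃ b ν κ α β α′ β′ c₃₅ p, 0 < b ∧ 0 < c₃₅ ∧ ∀ F ϑ hP g₀ os k, (𝔯.lit F ϑ hP g₀ os).ne2 k = allLayersBgObjects 3 F.hL b ν κ α β α′ β′ c₃₅ p`.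

HONEST FRAMING ∕ LIMITS.  By-name bookkeeping; no estimate.  The pinned objects are Σ-A's MODEL-LEVEL family (abelianised first-order species of (3.52)'s `V′(A)`, (C3) transport, abelianised `Q`,
linearised (1.66) dressing in the unit layer, exact (1.103) dressing in the site layer): ALL THREE layers READ `U`, Bałaban's size `M` live through `c₃₅·M·α₀`; NOT [B9] Thms 3.1∕3.2∕3.15 at
general `U` for the non-abelian `G(U)` (n15-c), NOT Node 00's objects of record; no pin is asked of the plan here (K3⁸ v7 keeps `N15PinnedSized` = S-B's U-blind `fullGSizedObjects`; the planner
decides); NE2⁺ NOT PRINTED ∕ NOT proved; N15 NOT discharged; counts of record UNMOVED by this seat (typed 28∕28 · discharged 7∕28); one finite 𝕋⁴ at fixed ε per index — NOT infinite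
volume, NOT OS on ℝ⁴, NOT a mass gap, NOT Clay.  No `sorry`, `instance`, `notation`, `maxHeartbeats`; standard axioms.
-/

noncomputable section

namespace Summit.QuantumFields.YangMills.BalabanUVNodes.N15.SiteLayerBg

open Literature.MathematicalPhysics.QuantumFieldTheory.Balaban1983to89
open Literature.MathematicalPhysics.QuantumFieldTheory.Balaban1983to89.T4Continuum (T4Family ULoop)
open Literature.MathematicalPhysics.QuantumFieldTheory.Balaban1983to89.B5Prop11Plancherel (Tor fine)
open Node00 (Stage13HParams NE2Objects₁₁)
open Summit.QuantumFields.YangMills.BalabanUVNodes.N15.TwoGrid (TGIndex foInstanceFG)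
open Summit.QuantumFields.YangMills.BalabanUVNodes.N15.GenuineRecord (TGIndexS tgIndexS_nonempty)
open Summit.QuantumFields.YangMills.BalabanUVNodes.N15.UnitLayerBg (exists_reg335_ne_one three_le_blockFactor)
open Summit.QuantumFields.YangMills.BalabanUVNodes.N15.AtKeyedHome (s_N15_of_admits neZero_blockFactor)
open Summit.QuantumFields.YangMills.BalabanUVNodes.N15.PairedFamilyGuard (Live KeyedLive)
open YMDAG.UVSplit (Datum NE2Carriers RateCarriers RateRecordPred N15At S_N15 ne2OfRecord₁₁ RateReading₁₃CoPH rateCarriersOfRecord₁₃CoPH)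

variable {d : ℕ} {L : ℕ} [NeZero L]

/-! ## §1 Non-vacuity -/

/-- **RR-1's DISPLAY HOLDS AT THE LITERAL**: `Populated` (the sized index is inhabited). [bookkeeping] -/
theorem populated_allLayersBgObjects (hL : Odd L ∧ 1 < L) (b : ℝ) (ν κ α β α' β' : Fin (d + 1)) (c35 p : ℝ) :
    (allLayersBgObjects d hL b ν κ α β α' β' c35 p).Populated :=
  (NE2Objects₁₁.populated_iff _).2 tgIndexS_nonempty

/-- ★ **THE BACKGROUND QUANTIFIER OF ALL THREE LAYERS IS NOT VOID ON THIS FAMILY**: at every index of the literal, every `α₀ > 0` (and `c₃₅ > 0`) the fine carrier's (3.35)-class contains a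
configuration OTHER than `one` (Λ-G `exists_reg335_ne_one` — the instance family IS `foInstanceFG`). [cite: Balaban1985BackgroundPropagators, (3.35) p.396 (shape)] -/
theorem exists_reg335_ne_one_allLayers (hL : Odd L ∧ 1 < L) (b : ℝ) (ν κ α β α' β' : Fin (d + 1)) {c35 : ℝ} (hc35 : 0 < c35) (p : ℝ)
    (j : (allLayersBgObjects d hL b ν κ α β α' β' c35 p).I) {α₀ : ℝ} (hα₀ : 0 < α₀) :
    ∃ U : ((allLayersBgObjects d hL b ν κ α β α' β' c35 p).pi j).Bf.Cfg,
      ((allLayersBgObjects d hL b ν κ α β α' β' c35 p).pi j).Bf.Reg335 c35 α₀ U ∧ U ≠ ((allLayersBgObjects d hL b ν κ α β α' β' c35 p).pi j).Bf.one :=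
  exists_reg335_ne_one hL j hc35 hα₀

/-! ## §2 The family-keyed editions (`d + 1 = 4`, block factor `F.L`) -/

/-- ★★ `N15At` AT THE FAMILY-KEYED LITERAL (`(d, L) := (3, F.L)`; `b, c₃₅ > 0`). [bookkeeping] -/
theorem n15At_allLayersBgObjects_family {b c35 : ℝ} (hb : 0 < b) (hc35 : 0 < c35) (ν κ α β α' β' : Fin 4) (p : ℝ) (F : T4Family) :
    N15At (ne2OfRecord₁₁ (haveI := neZero_blockFactor F; allLayersBgObjects 3 F.hL b ν κ α β α' β' c35 p)) := by
  haveI := neZero_blockFactor F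
  exact n15At_allLayersBgObjects (d := 3) (by norm_num) F.hL.1 (three_le_blockFactor F) F.hL hb hc35 ν κ α β α' β' p

/-- ★★ the family-keyed literal is LIVE (`c₃₅ ≥ 0`). [bookkeeping] -/
theorem live_allLayersBgObjects_family (b : ℝ) (ν κ α β α' β' : Fin 4) {c35 : ℝ} (hc35 : 0 ≤ c35) (p : ℝ) (F : T4Family) :
    Live (ne2OfRecord₁₁ (haveI := neZero_blockFactor F; allLayersBgObjects 3 F.hL b ν κ α β α' β' c35 p)) := by
  haveI := neZero_blockFactor F
  exact live_allLayersBgObjects F.hL b ν κ α β α' β' hc35 p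

/-- `Populated` at the family-keyed literal. [bookkeeping] -/
theorem populated_allLayersBgObjects_family (F : T4Family) (b : ℝ) (ν κ α β α' β' : Fin 4) (c35 p : ℝ) :
    (haveI := neZero_blockFactor F; allLayersBgObjects 3 F.hL b ν κ α β α' β' c35 p).Populated := by
  haveI := neZero_blockFactor F
  exact populated_allLayersBgObjects F.hL b ν κ α β α' β' c35 p

/-- ★★ **GUARD ∧ `N15At` FOR THE ALL-LAYERS-LIVE LITERAL IN THE FAMILY SPELLING** (`(d, L) := (3, F.L)`; `b, c₃₅ > 0`). [bookkeeping] -/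
theorem live_and_n15At_allLayersBgObjects_family (F : T4Family) {b c35 : ℝ} (hb : 0 < b) (hc35 : 0 < c35) (ν κ α β α' β' : Fin 4) (p : ℝ) :
    haveI := neZero_blockFactor F
    Live (ne2OfRecord₁₁ (allLayersBgObjects 3 F.hL b ν κ α β α' β' c35 p)) ∧ N15At (ne2OfRecord₁₁ (allLayersBgObjects 3 F.hL b ν κ α β α' β' c35 p)) :=
  ⟨live_allLayersBgObjects_family b ν κ α β α' β' hc35.le p F, n15At_allLayersBgObjects_family hb hc35 ν κ α β α' β' p F⟩

variable {N : ℕ} [NeZero N] {key : (F : T4Family) → Datum F N → Prop}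

/-- ★★ **THE FAMILY-KEYED READING AT ANY KEYED HOME** (part 30's interface; `(d, L) := (3, F.L)` at each family; `b, c₃₅ > 0`). [bookkeeping] -/
theorem s_N15_of_admits_allLayersBg_family {b c35 : ℝ} (hb : 0 < b) (hc35 : 0 < c35) (ν κ α β α' β' : Fin 4) (p : ℝ)
    (ne2At : ∀ {F : T4Family} {D : Datum F N}, key F D → (ℕ → ℝ) → List (ULoop F) → ℕ → NE2Objects₁₁) (RRec : RateRecordPred N)
    (hadm : ∀ (F : T4Family) (D : Datum F N) (g₀ : ℕ → ℝ) (os : List (ULoop F)) (R : RateCarriers N), RRec F D g₀ os R →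
      ∃ (h : key F D) (k : ℕ), R.ne2 = ne2OfRecord₁₁ (ne2At h g₀ os k))
    (h : ∀ (F : T4Family) (D : Datum F N) (h : key F D) (g₀ : ℕ → ℝ) (os : List (ULoop F)) (k : ℕ),
      ne2At h g₀ os k = haveI := neZero_blockFactor F; allLayersBgObjects 3 F.hL b ν κ α β α' β' c35 p) :
    S_N15 RRec := by
  refine s_N15_of_admits ne2At RRec hadm fun F D hk g₀ os k => ?_
  rw [h F D hk g₀ os k]
  exact n15At_allLayersBgObjects_family hb hc35 ν κ α β α' β' p F

/-! ## §3 Under a PIN of the reading's NE2 objects to the literal: the two `GuardedReading`-corner faces + `N15At` at every run length -/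

/-- ★★ **PINNED TO THE ALL-LAYERS-LIVE FAMILY ⟹ KEYED-LIVE, EVERY SELECTOR**: if the reading's N15 objects are `allLayersBgObjects 3 F.hL …` at every tuple and run length (for some `b, c₃₅ > 0`,
directions, `p`), then w2's `KeyedLive` holds at the bundle of record for every run-length selector. [bookkeeping] -/
theorem keyedLive_of_pinnedAllLayersBg (𝔯 : RateReading₁₃CoPH N)
    (hpin : ∃ (b : ℝ) (ν κ α β α' β' : Fin 4) (c35 p : ℝ), 0 < b ∧ 0 < c35 ∧
      ∀ (F : T4Family) (ϑ : Stage13HParams F N) (hP : ϑ.Provisos₁₃CoPH F N) (g₀ : ℕ → ℝ) (os : List (ULoop F)) (k : ℕ),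
        (𝔯.lit F ϑ hP g₀ os).ne2 k = haveI := neZero_blockFactor F; allLayersBgObjects 3 F.hL b ν κ α β α' β' c35 p)
    (ksel : (F : T4Family) → (ϑ : Stage13HParams F N) → ϑ.Provisos₁₃CoPH F N → (ℕ → ℝ) → List (ULoop F) → ℕ) :
    KeyedLive (fun F ϑ hP g₀ os => rateCarriersOfRecord₁₃CoPH 𝔯 F ϑ hP g₀ os (ksel F ϑ hP g₀ os)) := by
  obtain ⟨b, ν, κ, α, β, α', β', c35, p, -, hc35, h⟩ := hpin
  intro F ϑ hP _ _ g₀ os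
  show Live (ne2OfRecord₁₁ ((𝔯.lit F ϑ hP g₀ os).ne2 (ksel F ϑ hP g₀ os)))
  rw [h F ϑ hP g₀ os (ksel F ϑ hP g₀ os)]
  exact live_allLayersBgObjects_family b ν κ α β α' β' hc35.le p F

/-- ★★ **PINNED TO THE ALL-LAYERS-LIVE FAMILY ⟹ `Live ∧ N15At` AT EVERY BUNDLE OF RECORD** (every Stage-13 parameter with provisos, every `(g₀, os)`, every selector). [bookkeeping] -/
theorem live_and_n15At_rrOfRecord_of_pinnedAllLayersBg (𝔯 : RateReading₁₃CoPH N)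
    (hpin : ∃ (b : ℝ) (ν κ α β α' β' : Fin 4) (c35 p : ℝ), 0 < b ∧ 0 < c35 ∧
      ∀ (F : T4Family) (ϑ : Stage13HParams F N) (hP : ϑ.Provisos₁₃CoPH F N) (g₀ : ℕ → ℝ) (os : List (ULoop F)) (k : ℕ),
        (𝔯.lit F ϑ hP g₀ os).ne2 k = haveI := neZero_blockFactor F; allLayersBgObjects 3 F.hL b ν κ α β α' β' c35 p)
    (ksel : (F : T4Family) → (ϑ : Stage13HParams F N) → ϑ.Provisos₁₃CoPH F N → (ℕ → ℝ) → List (ULoop F) → ℕ)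
    (F : T4Family) (ϑ : Stage13HParams F N) (hP : ϑ.Provisos₁₃CoPH F N) (g₀ : ℕ → ℝ) (os : List (ULoop F)) :
    Live (rateCarriersOfRecord₁₃CoPH 𝔯 F ϑ hP g₀ os (ksel F ϑ hP g₀ os)).ne2 ∧ N15At (rateCarriersOfRecord₁₃CoPH 𝔯 F ϑ hP g₀ os (ksel F ϑ hP g₀ os)).ne2 := by
  obtain ⟨b, ν, κ, α, β, α', β', c35, p, hb, hc35, h⟩ := hpin
  show Live (ne2OfRecord₁₁ ((𝔯.lit F ϑ hP g₀ os).ne2 (ksel F ϑ hP g₀ os))) ∧ N15At (ne2OfRecord₁₁ ((𝔯.lit F ϑ hP g₀ os).ne2 (ksel F ϑ hP g₀ os)))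
  rw [h F ϑ hP g₀ os (ksel F ϑ hP g₀ os)]
  exact live_and_n15At_allLayersBgObjects_family F hb hc35 ν κ α β α' β' p

/-- ★★ **PINNED TO THE ALL-LAYERS-LIVE FAMILY ⟹ `N15At` AT EVERY RUN LENGTH** of every Stage-13 bundle (not only the selected one). [bookkeeping] -/
theorem n15At_lit_of_pinnedAllLayersBg (𝔯 : RateReading₁₃CoPH N)
    (hpin : ∃ (b : ℝ) (ν κ α β α' β' : Fin 4) (c35 p : ℝ), 0 < b ∧ 0 < c35 ∧
      ∀ (F : T4Family) (ϑ : Stage13HParams F N) (hP : ϑ.Provisos₁₃CoPH F N) (g₀ : ℕ → ℝ) (os : List (ULoop F)) (k : ℕ),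
        (𝔯.lit F ϑ hP g₀ os).ne2 k = haveI := neZero_blockFactor F; allLayersBgObjects 3 F.hL b ν κ α β α' β' c35 p)
    (F : T4Family) (ϑ : Stage13HParams F N) (hP : ϑ.Provisos₁₃CoPH F N) (g₀ : ℕ → ℝ) (os : List (ULoop F)) (k : ℕ) :
    N15At (ne2OfRecord₁₁ ((𝔯.lit F ϑ hP g₀ os).ne2 k)) := by
  obtain ⟨b, ν, κ, α, β, α', β', c35, p, hb, hc35, h⟩ := hpin
  rw [h F ϑ hP g₀ os k]
  exact n15At_allLayersBgObjects_family hb hc35 ν κ α β α' β' p F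

end Summit.QuantumFields.YangMills.BalabanUVNodes.N15.SiteLayerBg

end
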